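import Mathlib
import Literature.Computability.AlgebraicComplexity.SchoenhageTau
import Literature.Computability.AlgebraicComplexity.GroupAlgebraTensor

/-!
# `OrbitHarmonicsHosts.ReesBound` — graded tools: the Rees degeneration of a filtered quotient of `K[x]`

Route `MatrixMultiplication/OrbitHarmonicsHosts`, helpers for item `stmt-MatrixMultiplication-5458` (`ReesBound`:
the orbit-harmonics ring `ℂ[x]/⟨LF(I(P))⟩` of a finite point set has a basis of size `|P|` whose structure tensor
has border rank `≤ |P|`). Everything here is stated for an arbitrary ideal `I` of `MvPolynomial σ K` over a field
`K` and its top-form ideal `J = ⟨LF(f) : f ∈ I⟩` (`LF f = homogeneousComponent (totalDegree f) f`):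

* `exists_eq_homogeneousComponent_of_mem_grSpan` — degreewise description of `J`: every `p ∈ J` has, in each
  degree `k`, the degree-`k` component of some `g ∈ I` with `deg g ≤ k` (so `J = ⊕ₖ LF(I ∩ F_{≤ k})`).
* `algBorderRank_structureTensor_le_of_graded` — the Rees degeneration (easy half of Bläser–Lysikov 2016,
  "smoothable ⇒ minimal border rank", in Bläser's `K[ε]` border rank, Bläser 2013 Def. 6.1): if homogeneous `h k`
  (degrees `e k`) induce a basis of `R/J` and `h i h j - ∑ₖ c_{kij} h k ∈ I` where `c` is a sum of `r` triads, then
  comparing top forms gives `c_{kij} = 0` for `e k > e i + e j` and structure constants `[e k = e i + e j] c_{kij}`,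
  and rescaling the triads by `ε^{M-e k} ⊗ ε^{e i} ⊗ ε^{e j}` is an order-`M` approximate decomposition.
* `linearIndependent_map_of_graded`, `span_map_eq_top_of_graded` — transfer of a homogeneous basis of `R/J` to a
  basis of `R/I` (through any algebra map `Φ` with kernel `I`): the top-form trick and induction on the degree.

The point-set instance (`Φ` = evaluation at `P`, multivariate Lagrange interpolation, the count `|P|`) is in
`OrbitHarmonicsHostsReesBound.lean`. Mathlib + the tree's `SchoenhageTau` / `GroupAlgebraTensor` only.
-/

-- `Summit.<Summit>.<Problem>` is the tree's mandated summit-side namespace; for this single-conjunct summit the two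
-- components coincide, so the file silences `dupNamespace`.
set_option linter.dupNamespace false
set_option autoImplicit false

noncomputable section

open scoped BigOperators Polynomial
open MvPolynomial Literature.Computability.AlgebraicComplexity

namespace Summit.MatrixMultiplication.MatrixMultiplication.Theorems

section Graded

variable {K : Type*} [Field K] {σ : Type*}

/-- `(φ ψ)_k = φ · ψ_{k-i}` for `φ` homogeneous of degree `i ≤ k`, and `0` if `k < i` (graded ring structure of
`MvPolynomial`). -/
theorem homogeneousComponent_mul_of_isHomogeneous_left' {φ : MvPolynomial σ K} {i : ℕ}
    (hφ : φ.IsHomogeneous i) (ψ : MvPolynomial σ K) (k : ℕ) :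
    homogeneousComponent k (φ * ψ) = if i ≤ k then φ * homogeneousComponent (k - i) ψ else 0 := by
  letI := MvPolynomial.gradedAlgebra (σ := σ) (R := K)
  have h := DirectSum.coe_decompose_mul_of_left_mem (𝒜 := homogeneousSubmodule σ K) (b := ψ) k hφ
  have e1 : ((DirectSum.decompose (homogeneousSubmodule σ K) (φ * ψ)) k : MvPolynomial σ K) =
      homogeneousComponent k (φ * ψ) :=
    MvPolynomial.decomposition.decompose'_apply (φ * ψ) k
  have e2 : ((DirectSum.decompose (homogeneousSubmodule σ K) ψ) (k - i) : MvPolynomial σ K) =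
      homogeneousComponent (k - i) ψ :=
    MvPolynomial.decomposition.decompose'_apply ψ (k - i)
  rw [e1, e2] at h
  exact h

/-- The top form of `g ∈ I`, read in any degree `k ≥ deg g`, lies in the top-form ideal `⟨LF(I)⟩`. -/
theorem homogeneousComponent_mem_grSpan {I : Ideal (MvPolynomial σ K)} {g : MvPolynomial σ K}
    (hg : g ∈ I) {k : ℕ} (hk : g.totalDegree ≤ k) :
    homogeneousComponent k g ∈ Ideal.span ((fun f : MvPolynomial σ K =>
      homogeneousComponent f.totalDegree f) '' (I : Set (MvPolynomial σ K))) := by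
  rcases hk.lt_or_eq with hlt | heq
  · rw [homogeneousComponent_eq_zero _ _ hlt]
    exact Ideal.zero_mem _
  · subst heq
    exact Ideal.subset_span ⟨g, hg, rfl⟩

/-- **Degreewise description of the top-form ideal.** If `p ∈ ⟨LF(I)⟩` then every homogeneous component `p_k`
is the degree-`k` component of some `g ∈ I` with `deg g ≤ k` (i.e. `⟨LF(I)⟩ = ⊕_k LF(I ∩ F_{≤k})`). -/
theorem exists_eq_homogeneousComponent_of_mem_grSpan {I : Ideal (MvPolynomial σ K)}
    {p : MvPolynomial σ K} (hp : p ∈ Ideal.span ((fun f : MvPolynomial σ K =>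
      homogeneousComponent f.totalDegree f) '' (I : Set (MvPolynomial σ K)))) (k : ℕ) :
    ∃ g ∈ I, g.totalDegree ≤ k ∧ homogeneousComponent k g = homogeneousComponent k p := by
  induction hp using Submodule.span_induction generalizing k with
  | mem x hx =>
    obtain ⟨f, hf, rfl⟩ := hx
    by_cases hk : f.totalDegree = k
    · subst hk
      exact ⟨f, hf, le_rfl, by rw [homogeneousComponent_of_mem (homogeneousComponent_mem _ f), if_pos rfl]⟩
    · refine ⟨0, I.zero_mem, by simp, ?_⟩
      rw [map_zero, homogeneousComponent_of_mem (homogeneousComponent_mem _ f), if_neg (Ne.symm hk)]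
  | zero => exact ⟨0, I.zero_mem, by simp, rfl⟩
  | add x y _ _ ihx ihy =>
    obtain ⟨g₁, hg₁, hd₁, he₁⟩ := ihx k
    obtain ⟨g₂, hg₂, hd₂, he₂⟩ := ihy k
    exact ⟨g₁ + g₂, I.add_mem hg₁ hg₂, (totalDegree_add _ _).trans (max_le hd₁ hd₂),
      by rw [map_add, map_add, he₁, he₂]⟩
  | smul a x _ ihx =>
    choose g hgI hgd hge using ihx
    refine ⟨∑ i ∈ Finset.range (a.totalDegree + 1),
      (if i ≤ k then homogeneousComponent i a * g (k - i) else 0), ?_, ?_, ?_⟩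
    · refine Ideal.sum_mem _ fun i _ => ?_
      split_ifs
      · exact I.mul_mem_left _ (hgI _)
      · exact I.zero_mem
    · refine totalDegree_finsetSum_le fun i _ => ?_
      split_ifs with hik
      · refine (totalDegree_mul _ _).trans ?_
        have h1 := (homogeneousComponent_isHomogeneous i a).totalDegree_le
        have h2 := hgd (k - i)
        omega
      · simp
    · rw [map_sum, smul_eq_mul]
      conv_rhs => rw [← sum_homogeneousComponent a, Finset.sum_mul, map_sum]
      refine Finset.sum_congr rfl fun i _ => ?_
      rw [homogeneousComponent_mul_of_isHomogeneous_left' (homogeneousComponent_isHomogeneous i a) x k]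
      split_ifs with hik
      · rw [homogeneousComponent_mul_of_isHomogeneous_left' (homogeneousComponent_isHomogeneous i a),
          if_pos hik, hge]
      · rw [map_zero]

end Graded

section Core

variable {K : Type*} [Field K] {σ : Type*} {κ : Type*}

/-- Homogeneous components of a linear combination of homogeneous polynomials `h k` (degrees `e k`). -/
theorem homogeneousComponent_sum_smul {h : κ → MvPolynomial σ K} {e : κ → ℕ}
    (he : ∀ x, (h x).IsHomogeneous (e x)) (s : Finset κ) (a : κ → K) (m : ℕ) :
    homogeneousComponent m (∑ k ∈ s, a k • h k) = ∑ k ∈ s, (if e k = m then a k else 0) • h k := by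
  rw [map_sum]
  refine Finset.sum_congr rfl fun k _ => ?_
  rw [map_smul, homogeneousComponent_of_mem (he k)]
  by_cases hk : e k = m
  · rw [if_pos hk, if_pos hk.symm]
  · rw [if_neg hk, if_neg (Ne.symm hk), smul_zero, zero_smul]

variable [Fintype κ]

/-- Degree of a linear combination of homogeneous polynomials whose nonzero coefficients sit in degrees `≤ m`. -/
theorem totalDegree_sum_smul_le {h : κ → MvPolynomial σ K} {e : κ → ℕ}
    (he : ∀ x, (h x).IsHomogeneous (e x)) (a : κ → K) {m : ℕ} (hm : ∀ k, a k ≠ 0 → e k ≤ m) :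
    (∑ k, a k • h k).totalDegree ≤ m := by
  refine totalDegree_finsetSum_le fun k _ => ?_
  by_cases hk : a k = 0
  · simp [hk]
  · exact (totalDegree_smul_le _ _).trans ((he k).totalDegree_le.trans (hm k hk))

/-- **Rees degeneration (core).** Let `J ⊇ LF(I ∩ F_{≤k})_k` for all `k` (e.g. `J = ⟨LF(I)⟩`), let homogeneous
`h k` of degrees `e k` induce a basis `bA` of `R/J`, and let `c` be "structure constants modulo `I`":
`h i h j - ∑ k c_{kij} h k ∈ I`, with an exact decomposition of `c` into `r` triads. Then comparing top forms gives
`c_{kij} = 0` for `e k > e i + e j` and `bA`-structure constants `[e k = e i + e j] c_{kij}`, so rescaling the triads by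
`ε^{M-e k} ⊗ ε^{e i} ⊗ ε^{e j}` (`M = max e`) is an order-`M` approximate decomposition: `bR(structureTensor bA) ≤ r`
(Bläser 2013 Def. 6.1; the flat-family argument of Bläser–Lysikov 2016 for smoothable algebras, graded case). -/
theorem algBorderRank_structureTensor_le_of_graded
    {I J : Ideal (MvPolynomial σ K)}
    (hIJ : ∀ g ∈ I, ∀ k, g.totalDegree ≤ k → homogeneousComponent k g ∈ J)
    {h : κ → MvPolynomial σ K} {e : κ → ℕ} (he : ∀ x, (h x).IsHomogeneous (e x))
    (bA : Module.Basis κ K (MvPolynomial σ K ⧸ J))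
    (hbA : ∀ x, bA x = Ideal.Quotient.mkₐ K J (h x))
    (c : κ → κ → κ → K) (hc : ∀ i j, h i * h j - ∑ k, c k i j • h k ∈ I)
    {r : ℕ} (U V W : Fin r → κ → K) (hdec : ∀ k i j, c k i j = ∑ ρ, U ρ k * V ρ i * W ρ j) :
    algBorderRank (structureTensor bA) ≤ r := by
  classical
  -- a combination of the `h k` vanishing in `R/J` has zero coefficients
  have indep : ∀ a : κ → K, Ideal.Quotient.mkₐ K J (∑ k, a k • h k) = 0 → ∀ k, a k = 0 := by
    intro a ha
    rw [map_sum] at ha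
    simp_rw [map_smul, ← hbA] at ha
    exact Fintype.linearIndependent_iff.mp bA.linearIndependent a ha
  -- top-form comparison for `g = h i h j - ∑ c h`, read in a degree `m` bounding `deg g`
  have key : ∀ i j m, e i + e j ≤ m → (∀ k, c k i j ≠ 0 → e k ≤ m) →
      Ideal.Quotient.mkₐ K J ((if m = e i + e j then h i * h j else 0) -
        ∑ k, (if e k = m then c k i j else 0) • h k) = 0 := by
    intro i j m hm hcm
    have hdeg : (h i * h j - ∑ k, c k i j • h k).totalDegree ≤ m :=
      (totalDegree_sub _ _).trans (max_le (((he i).mul (he j)).totalDegree_le.trans hm)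
        (totalDegree_sum_smul_le he _ hcm))
    have hmem := hIJ _ (hc i j) m hdeg
    rw [map_sub, homogeneousComponent_of_mem ((he i).mul (he j)),
      homogeneousComponent_sum_smul he Finset.univ] at hmem
    rw [Ideal.Quotient.mkₐ_eq_mk]
    exact Ideal.Quotient.eq_zero_iff_mem.mpr hmem
  -- (i) `c_{kij} = 0` above the degree `e i + e j`
  have van : ∀ i j k, c k i j ≠ 0 → e k ≤ e i + e j := by
    intro i j
    by_contra hcon
    push Not at hcon
    obtain ⟨k₀, hk₀, hmax⟩ := Finset.exists_max_image
      (Finset.univ.filter fun k => c k i j ≠ 0 ∧ e i + e j < e k) e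
      (by obtain ⟨k, hk1, hk2⟩ := hcon; exact ⟨k, Finset.mem_filter.mpr ⟨Finset.mem_univ _, hk1, hk2⟩⟩)
    rw [Finset.mem_filter] at hk₀
    have hcm : ∀ k, c k i j ≠ 0 → e k ≤ e k₀ := by
      intro k hk
      by_cases hlt : e i + e j < e k
      · exact hmax k (Finset.mem_filter.mpr ⟨Finset.mem_univ _, hk, hlt⟩)
      · exact (not_lt.mp hlt).trans hk₀.2.2.le
    have h0 := key i j (e k₀) hk₀.2.2.le hcm
    rw [if_neg (ne_of_gt hk₀.2.2), zero_sub, map_neg, neg_eq_zero] at h0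
    have h1 := indep _ h0 k₀
    rw [if_pos rfl] at h1
    exact hk₀.2.1 h1
  -- (ii) the structure constants of `R/J` in the basis `bA`
  have struct : ∀ k i j, structureTensor bA k i j = if e k = e i + e j then c k i j else 0 := by
    intro k i j
    have h0 := key i j (e i + e j) le_rfl (van i j)
    rw [if_pos rfl, map_sub, sub_eq_zero, map_mul, map_sum] at h0
    simp_rw [map_smul, ← hbA] at h0
    rw [structureTensor_apply, h0, bA.repr_sum_self]
  -- (iii) the approximate decomposition of order `M = max e`
  set M := Finset.univ.sup e with hM
  have heM : ∀ k, e k ≤ M := fun k => Finset.le_sup (f := e) (Finset.mem_univ k)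
  have happ : IsApproxDecomposition M (structureTensor bA)
      (fun ρ k => Polynomial.C (U ρ k) * Polynomial.X ^ (M - e k))
      (fun ρ i => Polynomial.C (V ρ i) * Polynomial.X ^ (e i))
      (fun ρ j => Polynomial.C (W ρ j) * Polynomial.X ^ (e j)) := by
    intro k i j l _hl
    have hsum : (∑ ρ, Polynomial.C (U ρ k) * Polynomial.X ^ (M - e k) *
        (Polynomial.C (V ρ i) * Polynomial.X ^ (e i)) * (Polynomial.C (W ρ j) * Polynomial.X ^ (e j))) =
        Polynomial.C (c k i j) * Polynomial.X ^ (M - e k + (e i + e j)) := by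
      rw [hdec, map_sum, Finset.sum_mul]
      refine Finset.sum_congr rfl fun ρ _ => ?_
      rw [map_mul, map_mul]
      ring
    rw [hsum, Polynomial.coeff_C_mul_X_pow, struct]
    by_cases h1 : e k = e i + e j
    · have h2 : M - e k + (e i + e j) = M := by have := heM k; omega
      rw [h2, if_pos h1]
    · rw [if_neg h1, ite_self]
      by_cases h3 : e i + e j < e k
      · have h4 : c k i j = 0 := by
          by_contra h5
          exact absurd (van i j k h5) (not_le.mpr h3)
        rw [h4, ite_self]
      · have h4 : l ≠ M - e k + (e i + e j) := by have := heM k; omega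
        rw [if_neg h4]
  exact (algBorderRank_le_approxRank M _).trans (approxRank_le_of_isApproxDecomposition happ)

end Core

section Transfer

variable {K : Type*} [Field K] {σ : Type*} {κ : Type*} {B : Type*} [CommRing B] [Algebra K B]

/-- The top form of a nonzero polynomial is nonzero. -/
theorem homogeneousComponent_totalDegree_ne_zero {R : Type*} [CommSemiring R] {a : MvPolynomial σ R}
    (ha : a ≠ 0) : homogeneousComponent a.totalDegree a ≠ 0 := by
  classical
  obtain ⟨m, hm, hmax⟩ := Finset.exists_max_image a.support (fun m => m.degree) (support_nonempty.mpr ha)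
  have hdeg : m.degree = a.totalDegree :=
    le_antisymm (le_totalDegree hm) (Finset.sup_le fun m' hm' => hmax m' hm')
  intro h
  have h1 := congrArg (coeff m) h
  rw [coeff_homogeneousComponent, if_pos hdeg, coeff_zero] at h1
  exact (mem_support_iff.mp hm) h1

/-- For `deg f ≤ n`, `f` is the sum of its homogeneous components of degrees `0, …, n`. -/
theorem sum_homogeneousComponent_of_totalDegree_le (f : MvPolynomial σ K) {n : ℕ}
    (hn : f.totalDegree ≤ n) : ∑ i ∈ Finset.range (n + 1), homogeneousComponent i f = f := by
  conv_rhs => rw [← sum_homogeneousComponent f]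
  refine (Finset.sum_subset (Finset.range_mono (by omega)) fun i _ hi => ?_).symm
  rw [Finset.mem_range, not_lt] at hi
  exact homogeneousComponent_eq_zero _ _ (by omega)

/-- **Top-form trick.** If homogeneous `h x` are linearly independent in `R/J` (`J ⊇` the top forms of `I`) and
`Φ` kills only elements of `I`, then the `Φ (h x)` are linearly independent: a vanishing combination `g = ∑ a h`
lies in `I`, so its top form — the sub-combination of top degree — vanishes in `R/J`. -/
theorem linearIndependent_map_of_graded {I J : Ideal (MvPolynomial σ K)}
    (hIJ : ∀ g ∈ I, ∀ k, g.totalDegree ≤ k → homogeneousComponent k g ∈ J)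
    (Φ : MvPolynomial σ K →ₐ[K] B) (hΦ : ∀ f, Φ f = 0 → f ∈ I)
    {h : κ → MvPolynomial σ K} {e : κ → ℕ} (he : ∀ x, (h x).IsHomogeneous (e x))
    (bA : Module.Basis κ K (MvPolynomial σ K ⧸ J)) (hbA : ∀ x, bA x = Ideal.Quotient.mkₐ K J (h x)) :
    LinearIndependent K (fun x => Φ (h x)) := by
  classical
  rw [linearIndependent_iff']
  intro s a hs
  have hli := linearIndependent_iff'.mp bA.linearIndependent s
  -- the combination `g = ∑ a h` lies in `I`
  have hg : ∑ i ∈ s, a i • h i ∈ I := hΦ _ (by rw [map_sum]; simpa only [map_smul] using hs)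
  suffices h0 : ∑ i ∈ s, a i • h i = 0 by
    refine hli a ?_
    have h1 := congrArg (Ideal.Quotient.mkₐ K J) h0
    rw [map_sum, map_zero] at h1
    simpa only [map_smul, ← hbA] using h1
  by_contra hne
  refine homogeneousComponent_totalDegree_ne_zero hne ?_
  have hmem := hIJ _ hg _ le_rfl
  rw [homogeneousComponent_sum_smul he] at hmem ⊢
  have hzero : ∀ i ∈ s, (if e i = (∑ i ∈ s, a i • h i).totalDegree then a i else 0) = 0 := by
    refine hli _ ?_
    have h1 := Ideal.Quotient.eq_zero_iff_mem.mpr hmem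
    rw [← Ideal.Quotient.mkₐ_eq_mk K, map_sum] at h1
    simpa only [map_smul, ← hbA] using h1
  exact Finset.sum_eq_zero fun i hi => by rw [hzero i hi, zero_smul]

/-- **Spanning.** If `J = ⟨LF(I)⟩` degreewise (every `p ∈ J` has `p_k = g_k` for some `g ∈ I`, `deg g ≤ k`),
homogeneous `h x` induce a basis of `R/J`, and `Φ` is a surjection killing `I`, then the `Φ (h x)` span:
by induction on the degree, `Φ f_n = ∑ a Φ(h) + Φ g - Φ(g - g_n)` with `deg (g - g_n) < n`. -/
theorem span_map_eq_top_of_graded [Fintype κ] {I J : Ideal (MvPolynomial σ K)}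
    (hJ : ∀ p ∈ J, ∀ k, ∃ g ∈ I, g.totalDegree ≤ k ∧ homogeneousComponent k g = homogeneousComponent k p)
    (Φ : MvPolynomial σ K →ₐ[K] B) (hΦI : ∀ f ∈ I, Φ f = 0) (hΦs : Function.Surjective Φ)
    {h : κ → MvPolynomial σ K} {e : κ → ℕ} (he : ∀ x, (h x).IsHomogeneous (e x))
    (bA : Module.Basis κ K (MvPolynomial σ K ⧸ J)) (hbA : ∀ x, bA x = Ideal.Quotient.mkₐ K J (h x)) :
    ⊤ ≤ Submodule.span K (Set.range fun x => Φ (h x)) := by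
  classical
  set S := Submodule.span K (Set.range fun x => Φ (h x)) with hS
  have hmemS : ∀ x, Φ (h x) ∈ S := fun x => Submodule.subset_span ⟨x, rfl⟩
  -- every polynomial of degree `≤ n` maps into `S`, by strong induction on `n`
  have main : ∀ n (f : MvPolynomial σ K), f.totalDegree ≤ n → Φ f ∈ S := by
    intro n
    induction n using Nat.strong_induction_on with
    | _ n ih =>
      intro f hf
      -- lower components are covered by the induction hypothesis
      have lower : ∀ g : MvPolynomial σ K,
          Φ (∑ i ∈ Finset.range n, homogeneousComponent i g) ∈ S := by
        intro g
        rw [map_sum]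
        exact Submodule.sum_mem _ fun i hi => ih i (Finset.mem_range.mp hi) _
          (homogeneousComponent_isHomogeneous i g).totalDegree_le
      -- the top component: write it in the basis modulo `J` and correct by an element of `I`
      have top : Φ (homogeneousComponent n f) ∈ S := by
        set a : κ → K := fun x => bA.repr (Ideal.Quotient.mkₐ K J (homogeneousComponent n f)) x
        have hq : homogeneousComponent n f - ∑ x, a x • h x ∈ J := by
          rw [← Ideal.Quotient.eq, ← Ideal.Quotient.mkₐ_eq_mk K, map_sum]
          simp_rw [map_smul, ← hbA]
          exact (bA.sum_repr _).symm
        obtain ⟨g, hgI, hgd, hge⟩ := hJ _ hq n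
        rw [map_sub, homogeneousComponent_of_mem (homogeneousComponent_mem n f), if_pos rfl,
          homogeneousComponent_sum_smul he] at hge
        -- `f_n = g_n + ∑ a' h` and `g_n = g - (lower part of g)`
        have hsplit : homogeneousComponent n f =
            (g - ∑ i ∈ Finset.range n, homogeneousComponent i g) +
              ∑ x, (if e x = n then a x else 0) • h x := by
          have hg := sum_homogeneousComponent_of_totalDegree_le g hgd
          rw [Finset.sum_range_succ] at hg
          have hgn : g - ∑ i ∈ Finset.range n, homogeneousComponent i g = homogeneousComponent n g := by
            rw [sub_eq_iff_eq_add, add_comm]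
            exact hg.symm
          rw [hgn, hge, sub_add_cancel]
        rw [hsplit, map_add, map_sub, hΦI g hgI, zero_sub]
        refine Submodule.add_mem _ (Submodule.neg_mem _ (lower g)) ?_
        rw [map_sum]
        exact Submodule.sum_mem _ fun x _ => by rw [map_smul]; exact Submodule.smul_mem _ _ (hmemS x)
      have hf' := sum_homogeneousComponent_of_totalDegree_le f hf
      rw [Finset.sum_range_succ] at hf'
      rw [← hf', map_add]
      exact Submodule.add_mem _ (lower f) top
  intro w _
  obtain ⟨f, rfl⟩ := hΦs w
  exact main _ f le_rfl

end Transfer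

end Summit.MatrixMultiplication.MatrixMultiplication.Theorems

end
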